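import Mathlib
import HarnessLib
import Summits.HubbardSuperconductivity.HubbardSuperconductivity.Theorems.KLProgrammeKLRegimeEngineV8PairTransferExport3
import Summits.HubbardSuperconductivity.HubbardSuperconductivity.Theorems.KLProgrammeKLRegimeEngineV8PairTransferRelBar

/-!
# Route `KLProgramme` — ENGINE child gen 8 (stmt-HubbardSuperconductivity-20437 `KLRegimeEngineV17F2`), skeleton-v2 export class #5 «(S)-transfer», TEXT REV 3
# (RELATIVE family, plan g20 (R54f)–(R54n), G1 = PASS 2026-08-27T23:31:59Z): the KEYED relative family `PairTransferRelFamilyK`, the v2-COMPOSABLE STEP PROP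
# `PairTransferStep4` over it, its deferred package `klTransferPkg4 / klCT4 / klCTu4`, the UNROLL `pairTransferRelFamilyK_all_of_step4`, and the bridge to rev 2's
# pinned family (cell gate-hubbard-kl, seat p1b g13 = 20437 registrant, class-#5 PLUMBING owner per pen (R59ak)/(R54m); the RELATIVE MODEL layer — `klSoftMass`,
# `klMemberArrayF`, `PairTransferRelAt/RelFamily`, `pairTransferPinnedAt_of_rel` — is k3c1-p1 g10's p585429, the pair bar `transferBarRelAt` (on the DERIVED profiles
# `klRelGain`/`transferBarRelAtW`, no `G.phGain` inside) is k3c1-p1 g10's p586507; both untouched)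

WHY A FOURTH STEP PROP.  Rev 2's pinned step (`PairTransferStep3`, p581298 over p576787's `PairTransferPinnedFamily`) cannot be PRODUCED: the located risk
«(c)-#5-DEFECT-BUDGET» (k3c1-p1 g10 CLASS5-DEFECT-BUDGET b3e7bdaa64abed99; p1 g12 CLASS5-COMPOSE-BUDGET 5aaa80e1f4db194e, kernel form p583551/p584049
`transferBarAt_succ_lt_klEngGeo8`) — inheritance through the resummation square is additive with coefficient 1 while `transferBarAt` is gained.  The cure typed and
landed for G1 compares TWO MEMBERS directly: `PairTransferRelFamily L M β U μ n TB` (p585429) with the residue in units of the SOFT MASS of `ψ₁ − ψ₂`, which quadruples per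
step for a fixed symbol (`klSoftMass_succ`) — coefficient-1/4 inheritance, the inequality the compose route lacked (doors `kltc_relative_flow_duhamel` p583555,
`kltc_relative_step_fwd` p584594).  Pen (R54n) makes rev 8 of the v2 render NAMES-ONLY: this file therefore keeps Export3's binder list, package type and every argument
list BYTE-VERBATIM and changes exactly the family predicate, through a KEYED WRAPPER with the pinned family's arity:

* §1 **`PairTransferRelFamilyK L M G P r β U μ n := PairTransferRelFamily L M β U μ n (transferBarRelAt L M G P r β U μ n)`** (pen's name; the pair bar of
  `(ψ₁ | ψ₂)` is `transferBarRelAtW` at the soft mass and the born overlap of `ψ₁ − ψ₂` at `Kₙ`, p586507), and the bridge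
  `PairTransferRelFamilyK.pinnedFamily` (= p585429's `PairTransferRelFamily.pinnedFamily` at the keyed bar: ONE hosting inequality gives rev 2's
  `PairTransferPinnedFamily … n`, so step 3 p581707 and the (c) closer read the rev-3 binder unchanged);
* §2 `IsTransferPkg4` (= `IsTransferPkg3` verbatim, suffixed for the rev), **`PairTransferStep4 P R Q₀ r u`** (binders = `PairTransferStep3`'s verbatim; history
  `∀ j < n, PairTransferRelFamilyK … j`, conclusion `PairTransferRelFamilyK … n`), `klTransferPkg4 / klCT4 / klCTu4` (`klCT4_nonneg`, `klCTu4_pos`),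
  `pairTransferStep4_klCT4_of_exists/_of`;
* §3 **`pairTransferRelFamilyK_all_of_step4`** — the unroll (`exports_all_of_step₂`), the term §C's `htr` line calls (argument list = `pairTransferPinnedFamily_all_of_step3`'s).
Render tokens (v2 rev 8, (X).3 / (c) / §C / §P3): `IsTransferPkg3 ↦ IsTransferPkg4`, `PairTransferStep3 ↦ PairTransferStep4`, `PairTransferPinnedFamily ↦ PairTransferRelFamilyK`,
`klCT3 ↦ klCT4`, `klCTu3 ↦ klCTu4`, `pairTransferStep3_klCT3_of_exists ↦ pairTransferStep4_klCT4_of_exists`, `pairTransferPinnedFamily_all_of_step3 ↦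
pairTransferRelFamilyK_all_of_step4`; DefsU11's class-#5 row reads `klCTu4 P R (klEngQ7 P R) (klEngQ9c P R) cc` under G2 ADOPT.
Definitions with bodies + bookkeeping; nothing about the model is asserted (the relative clauses are the class-#5 producer's obligation, stub (X).3); nothing asserts
any stub of 20437, K3 or superconductivity.  0 kit · 0 lit.
-/

noncomputable section

namespace Summit.HubbardSuperconductivity.HubbardSuperconductivity.Theorems.EngineV8

set_option linter.dupNamespace false -- summit = problem name (single-conjunct summit), D-0017

open Real Finset Literature.MathematicalPhysics.QuantumLattice Literature.Probability.LatticeModels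
open Literature.MathematicalPhysics.QuantumLattice.FermiRG
open Summit.HubbardSuperconductivity.HubbardSuperconductivity.Theorems.KLProgrammeLegKernels
open Summit.HubbardSuperconductivity.HubbardSuperconductivity.Theorems.DispersionFlow
open Summit.HubbardSuperconductivity.HubbardSuperconductivity.Theorems.KLRegimeSplit

/-! ## §1 The keyed relative family and its bridge to rev 2 -/

section Keyed

variable (L M : ℕ) [NeZero L] [NeZero M]

/-- **`PairTransferRelFamilyK L M G P r β U μ n`** — class #5 rev 3's invariant in the PINNED FAMILY'S ARITY (pen (R54n), names-only rev 8): p585429's relative family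
`PairTransferRelFamily L M β U μ n TB` at the KEYED pair bar `TB := transferBarRelAt L M G P r β U μ n` (k3c1-p1's p586507: `transferBarRelAtW` at the soft mass
and the born overlap of `ψ₁ − ψ₂` at the flowing frame `Kₙ`): the relative clause at every ordered pair `ψ₂ ≤ ψ₁` of symbols admissible at `(Kₙ, n)`, residue `≤` the
pair bar of `(ψ₁ | ψ₂)`. -/
def PairTransferRelFamilyK (G : GeoConsts) (P : SplitConsts) (r β U μ : ℝ) (n : ℕ) : Prop :=
  PairTransferRelFamily L M β U μ n (transferBarRelAt L M G P r β U μ n)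

variable {L M}

/-- Unfolding lemma: the keyed family IS the relative family at the keyed bar. -/
theorem pairTransferRelFamilyK_iff (G : GeoConsts) (P : SplitConsts) (r β U μ : ℝ) (n : ℕ) :
    PairTransferRelFamilyK L M G P r β U μ n ↔ PairTransferRelFamily L M β U μ n (transferBarRelAt L M G P r β U μ n) := Iff.rfl

/-- **BRIDGE to rev 2** (p585429's `PairTransferRelFamily.pinnedFamily` at the keyed bar): if the keyed pair bar at every pair `(ψ | 0)`, `ψ` admissible, is hosted by
`transferBarAt … r′ … n`, the keyed relative family gives rev 2's `PairTransferPinnedFamily L M G P r′ β U μ n` — so step 3 (`pairLadderStepAtV17F2_of_pairTransferPinnedAt`,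
p581707) and the (c) closer read the rev-3 binder through ONE hosting inequality (RelBar's). -/
theorem PairTransferRelFamilyK.pinnedFamily {G : GeoConsts} {P : SplitConsts} {r r' β U μ : ℝ} {n : ℕ} (h : PairTransferRelFamilyK L M G P r β U μ n)
    (hle : ∀ ψ, IsSoftSymbol L M β μ (klFlowFrameU L M β U μ n) n ψ →
      ∀ Qm k k', transferBarRelAt L M G P r β U μ n ψ (fun _ => 0) Qm k k' ≤ transferBarAt L G P r' β U n Qm k k') :
    PairTransferPinnedFamily L M G P r' β U μ n :=
  PairTransferRelFamily.pinnedFamily h hle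

end Keyed

/-! ## §2 The v2-composable step, the admissible packages, the deferred package -/

/-- **An admissible class-#5 package, rev 3** (= `IsTransferPkg3` VERBATIM, suffixed so that every rev-3 token reads `…4`): a nonnegative transfer constant and a coupling
threshold POSITIVE at every raised package. -/
def IsTransferPkg4 (e : ℝ × (EngConsts → ℝ → ℝ)) : Prop := 0 ≤ e.1 ∧ ∀ Q cc, 0 < e.2 Q cc

/-- `IsTransferPkg4` and `IsTransferPkg3` are the same predicate. -/
theorem isTransferPkg4_iff_isTransferPkg3 (e : ℝ × (EngConsts → ℝ → ℝ)) : IsTransferPkg4 e ↔ IsTransferPkg3 e := Iff.rfl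

/-- **`PairTransferStep4 P R Q₀ r u`** — class #5's induction step, rev 3, in the v2-COMPOSABLE shape: `PairTransferStep3`'s binder list BYTE-VERBATIM (every geometry
package `G` (`G.WF`), every RAISE `Q` of the key package `Q₀`, `0 < cc ≤ klEngC₃6 P R`, `μ ∈ klWindowC`, `0 < U ≤ klEngU₀10 P R cc`, the step's own threshold
`U ≤ u Q cc`, `klBetaMin ≤ β ≤ e^{cc/U²}`, `klEngL₄ P R β U ≤ L`, `klEngM₃ β U L ≤ M`, `n ≤ nScales β + 1`, `IsKLRegime`, the public history AT `Q`, the admissibility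
of `Kₙ`, the class-#1 MERGED exports at every `j ≤ n`) with the KEYED RELATIVE families at every `j < n` as history and at `n` as conclusion.  Inside the producer the
pair `(ψ₁ | ψ₂)` at `n` comes from `(ψ₁ + sₙ | ψ₂ + sₙ)` at `n − 1` with the SAME difference, so the inherited allowance carries the factor `1/4` (`klSoftMass_succ`). -/
def PairTransferStep4 (P : SplitConsts) (R : RenConsts) (Q₀ : EngConsts) (r : ℝ) (u : EngConsts → ℝ → ℝ) : Prop :=
  ∀ G : GeoConsts, G.WF → ∀ Q : EngConsts, Q₀.IsRaiseOf Q →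
    ∀ cc : ℝ, 0 < cc → cc ≤ klEngC₃6 P R →
      ∀ μ ∈ klWindowC, ∀ U : ℝ, 0 < U → U ≤ klEngU₀10 P R cc → U ≤ u Q cc →
        ∀ β : ℝ, klBetaMin ≤ β → β ≤ Real.exp (cc / U ^ 2) →
          ∀ (L M : ℕ) [NeZero L] [NeZero M], klEngL₄ P R β U ≤ L → klEngM₃ β U L ≤ M →
            ∀ n : ℕ, n ≤ nScales β + 1 → IsKLRegime U cc (-(n : ℤ)) →
              HistP klPredsV17F2 L M G P Q R β U μ 0 n →
                FrameOK R U (nScales β) μ (klFlowFrameU L M β U μ n) →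
                  (∀ j ≤ n, LevelsUExportMixedAt L M (klCU2 P R Q₀) P β U μ j) →
                    (∀ j < n, PairTransferRelFamilyK L M G P r β U μ j) →
                      PairTransferRelFamilyK L M G P r β U μ n

/-- The trivial package `(0, 1)` is admissible. -/
theorem isTransferPkg4_zero : IsTransferPkg4 (0, fun _ _ => 1) := ⟨le_rfl, fun _ _ => one_pos⟩

section Deferred

variable (P : SplitConsts) (R : RenConsts) (Q₀ : EngConsts)

/-- **The deferred transfer package, rev 3**: SOME admissible `(r, u)` for which `PairTransferStep4 P R Q₀ r u` holds, if one exists, else the trivial package. -/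
def klTransferPkg4 : ℝ × (EngConsts → ℝ → ℝ) :=
  open scoped Classical in
  if h : ∃ e : ℝ × (EngConsts → ℝ → ℝ), IsTransferPkg4 e ∧ PairTransferStep4 P R Q₀ e.1 e.2 then Classical.choose h else (0, fun _ _ => 1)

/-- **The deferred transfer constant `klCT4 P R Q₀`** — a closed term today, adequate the day the class-#5 producer proves `PairTransferStep4 P R Q₀ r u` for an
admissible package (`pairTransferStep4_klCT4_of_exists`; stub (X).3 of 20437 v2 rev 8). -/
def klCT4 : ℝ := (klTransferPkg4 P R Q₀).1

/-- **The deferred coupling threshold `klCTu4 P R Q₀ : EngConsts → ℝ → ℝ`** (DefsU11's class-#5 row reads it at `(klEngQ9c P R, cc)` under G2 ADOPT). -/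
def klCTu4 : EngConsts → ℝ → ℝ := (klTransferPkg4 P R Q₀).2

/-- The deferred package is admissible (unconditionally). -/
theorem isTransferPkg4_klTransferPkg4 : IsTransferPkg4 (klTransferPkg4 P R Q₀) := by
  classical
  unfold klTransferPkg4
  split_ifs with h
  · exact (Classical.choose_spec h).1
  · exact isTransferPkg4_zero

/-- `0 ≤ klCT4 P R Q₀` (unconditionally). -/
theorem klCT4_nonneg : 0 ≤ klCT4 P R Q₀ := (isTransferPkg4_klTransferPkg4 P R Q₀).1

/-- `0 < klCTu4 P R Q₀ Q cc` (unconditionally) — so a `min` with it keeps the engine's U-door positive. -/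
theorem klCTu4_pos (Q : EngConsts) (cc : ℝ) : 0 < klCTu4 P R Q₀ Q cc := (isTransferPkg4_klTransferPkg4 P R Q₀).2 Q cc

variable {P R Q₀}

/-- **The step holds for the deferred package as soon as it holds for some admissible package** (how §C reads (X).3). -/
theorem pairTransferStep4_klCT4_of_exists (h : ∃ e : ℝ × (EngConsts → ℝ → ℝ), IsTransferPkg4 e ∧ PairTransferStep4 P R Q₀ e.1 e.2) :
    PairTransferStep4 P R Q₀ (klCT4 P R Q₀) (klCTu4 P R Q₀) := by
  classical
  have hpkg : klTransferPkg4 P R Q₀ = Classical.choose h := by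
    unfold klTransferPkg4
    rw [dif_pos h]
  unfold klCT4 klCTu4
  rw [hpkg]
  exact (Classical.choose_spec h).2

/-- Packaging an explicit witness. -/
theorem pairTransferStep4_klCT4_of {r : ℝ} {u : EngConsts → ℝ → ℝ} (hr : 0 ≤ r) (hu : ∀ Q cc, 0 < u Q cc) (hs : PairTransferStep4 P R Q₀ r u) :
    PairTransferStep4 P R Q₀ (klCT4 P R Q₀) (klCTu4 P R Q₀) :=
  pairTransferStep4_klCT4_of_exists ⟨(r, u), ⟨hr, hu⟩, hs⟩

end Deferred

/-! ## §3 The unroll (the term §C's `htr` line calls) -/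

section Unroll

variable {P : SplitConsts} {R : RenConsts} {Q₀ Q : EngConsts} {G : GeoConsts} {cc μ U β : ℝ} {L M : ℕ} [NeZero L] [NeZero M]

/-- **CLASS #5 UNROLLED, rev 3**: from `PairTransferStep4 P R Q₀ r u`, a geometry package `G` (`G.WF`), a raise `Q` of `Q₀`, the v2 binders, the bare frame's
admissibility `h0`, `R.WF2`, the public history up to `n ≤ n_β + 1` AT `Q` and the class-#1 merged exports at every `j ≤ n`: the keyed relative family at EVERY `j ≤ n`
(argument list = `pairTransferPinnedFamily_all_of_step3`'s verbatim). -/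
theorem pairTransferRelFamilyK_all_of_step4 {r : ℝ} {u : EngConsts → ℝ → ℝ} (hstep : PairTransferStep4 P R Q₀ r u) (hG : G.WF) (hQ : Q₀.IsRaiseOf Q)
    (hcc0 : 0 < cc) (hcc : cc ≤ klEngC₃6 P R) (hμ : μ ∈ klWindowC) (h0 : FrameOK R U (nScales β) μ 0) (hU : 0 < U) (hU10 : U ≤ klEngU₀10 P R cc)
    (hUu : U ≤ u Q cc) (hβ : klBetaMin ≤ β) (hβc : β ≤ Real.exp (cc / U ^ 2)) (hL : klEngL₄ P R β U ≤ L) (hM : klEngM₃ β U L ≤ M) (hR : R.WF2)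
    {n : ℕ} (hn : n ≤ nScales β + 1) (hhist : HistP klPredsV17F2 L M G P Q R β U μ 0 n)
    (hlev : ∀ j ≤ n, LevelsUExportMixedAt L M (klCU2 P R Q₀) P β U μ j) : ∀ j ≤ n, PairTransferRelFamilyK L M G P r β U μ j :=
  exports_all_of_step₂ (E := fun j => LevelsUExportMixedAt L M (klCU2 P R Q₀) P β U μ j) (F := fun j => PairTransferRelFamilyK L M G P r β U μ j) (N := n)
    hlev
    (fun m hm hE hist => by
      have hmn : m ≤ nScales β + 1 := hm.trans hn
      have hhm : HistP klPredsV17F2 L M G P Q R β U μ 0 m := histP_klPredsV17F2_of_le hhist hm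
      exact hstep G hG Q hQ cc hcc0 hcc μ hμ U hU hU10 hUu β hβ hβc L M hL hM m hmn (isKLRegime_of_le_nScales_succ hcc0.le hβ hβc hmn) hhm
        (frameOK_klFlowFrameU_of_histP hR h0 hmn hhm) hE hist)
    n le_rfl

end Unroll

end Summit.HubbardSuperconductivity.HubbardSuperconductivity.Theorems.EngineV8

end
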